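import Summits.HodgeConjecture.HodgeConjecture.Theorems.F0P6aRoofWInstantiation
import HarnessLib
import HarnessLib.Audit.LibrarySuggestionsDenyListCruxes

/-! Import notes («M-142a» (A): canonical bare header; the per-import commentary lives here):
* `Summits.HodgeConjecture.HodgeConjecture.Theorems.F0P6aRoofWInstantiation` — ★ twin (LAST part; part 1 rides the import) of tree `Lines/F0_P6a_RoofWInstantiation.lean` 2afdc2492f43fe94 (458 l.) -/

/-! # F0_P6a_RoofWInstantiation — NEXT EDITION = SHIM (★ re-home, IMPORT-ONLY; K6 L3 column, dealer LA3-plan (g5) PLAN v2).  The 5 declaration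
commands of this workfile (namespace `Summit.HodgeConjecture.HodgeConjecture.Cruxes.HLiu418.F0P6aRoofWInstantiation` KEPT ⇒ identical fully-qualified
names) now live in ★ `Theorems/F0P6aRoofWInstantiationHead.lean` (tree :1–:307) → ★ `Theorems/F0P6aRoofWInstantiation.lean` (tree :308–:458) — the
tree bytes of 2afdc2492f43fe94 split ×2 by the size lint at command-block seams (sections re-opened and their `variable`∕`open`∕`set_option` lines
replayed verbatim in later parts), with its `Lines/` imports switched to their ★ re-homes, 0 statement ∕ proof bytes changed.  This file only imports
the last part (transitively all), so the module `…Cruxes.HLiu418.Lines.F0_P6a_RoofWInstantiation` keeps serving every name to its importers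
(Lines-tree importers: `F0_P6a_StubFROBRoofGeoWiring` — each switches to the ★ module in its own twin ∕ shim).  It declares nothing.  Edition history
stays in git; future changes are ★-side proposals on the `Theorems/` parts.  HC_CM is proved only modulo the 7 printed citations (2 remaining named
inputs hLiu418 = stmt-HodgeConjecture-24832, h413 = stmt-HodgeConjecture-24833) until rung 0 closes; count-neutral (0 `sorry`, 0 socket, 0
declaration). -/
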